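import Summits.QuantumAdvantage.QuantumAdvantage.Theorems.OddPrimeWalkOddLocalSystems

/-!
# Item stmt-QuantumAdvantage-23991 `LocalTwoThirdsLaw` — part 3/4: free positions, class sizes, fibres, cells (S5a–S5b, S3′, S1′, S4′)

AUTHORED AND PROVED BY THE PLANNER SEAT qa-qnc0-p2 g29 (`HOME/qa-qnc0-p2/line29/LocalTwoThirds23991.lean`, 1082 lines, farm
rc 0 / 0 sorry); landed verbatim (split for the 400-line rule, one-line docstrings added) by qn-prover-3 g18, ask P2-29g.
WHAT THIS IS NOT: separation NOT moved.
-/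

namespace Summit.QuantumAdvantage.AdviceFreeQNC0.OddLocal

open Finset Literature.Computability.MetaComplexity

variable {n : ℕ}

/-- free positions of segment `j` (outside the windows). -/
def Free (m₀ w : ℕ) (j : Fin 4) : Finset (Fin n) :=
  univ.filter fun l : Fin n => ¬ inWindow m₀ w l.val ∧ segOf m₀ w l.val = j

/-- normalised patterns of segment `j` with window word `ω`: equal to `ω` on the windows, zero off
windows ∪ segment `j`. -/
def Pat (m₀ w : ℕ) (ω : Fin n → Bool) (j : Fin 4) : Finset (Fin n → Bool) :=
  univ.filter fun s => (∀ l : Fin n, inWindow m₀ w l.val → s l = ω l) ∧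
    (∀ l : Fin n, ¬ inWindow m₀ w l.val → segOf m₀ w l.val ≠ j → s l = false)

/-- … of class `a`. -/
def pats (m₀ w : ℕ) (ω : Fin n → Bool) (j : Fin 4) (a : Fin 3) : Finset (Fin n → Bool) :=
  (Pat m₀ w ω j).filter fun s => wtSeg m₀ w j s % 3 = a.val

/-- the cell of the class vector `a`: 4-tuples of normalised patterns of classes `a j`. -/
def cell (m₀ w : ℕ) (ω : Fin n → Bool) (a : Fin 4 → Fin 3) : Finset (Fin 4 → Fin n → Bool) :=
  Fintype.piFinset fun j => pats m₀ w ω j (a j)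

/-- the window word of an input (zero off the windows). -/
def wproj (m₀ w : ℕ) (u : Fin n → Bool) : Fin n → Bool :=
  fun l => if inWindow m₀ w l.val then u l else false

/-! ### S5a — every segment has at least `m₀` free positions -/

/-- Auxiliary `free_ge` of the local two-thirds law (planner qa-qnc0-p2 g29, `LocalTwoThirds23991.lean`, verbatim). -/
theorem free_ge (m₀ w : ℕ) (hn : 6 * w + 4 * m₀ ≤ n) (j : Fin 4) : m₀ ≤ (Free m₀ w j (n := n)).card := by
  classical
  -- segment `j` contains the `m₀` free positions `off_j + i`, `off_j = j·(m₀ + 2w)`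
  have hmem : ∀ i : ℕ, i < m₀ → j.val * (m₀ + 2 * w) + i < n ∧
      ¬ inWindow m₀ w (j.val * (m₀ + 2 * w) + i) ∧ segOf m₀ w (j.val * (m₀ + 2 * w) + i) = j := by
    intro i hi
    unfold inWindow segOf
    rw [sep_one, sep_two, sep_three]
    fin_cases j <;> simp only [Fin.isValue, Fin.reduceFinMk] <;>
      refine ⟨by omega, by omega, ?_⟩ <;> split_ifs <;> first | rfl | (exfalso; omega)
  calc m₀ = (univ : Finset (Fin m₀)).card := by simp
    _ ≤ (Free m₀ w j (n := n)).card := by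
      refine Finset.card_le_card_of_injOn
        (fun i : Fin m₀ => (⟨j.val * (m₀ + 2 * w) + i.val, (hmem i.val i.isLt).1⟩ : Fin n)) ?_ ?_
      · intro i _
        rw [mem_coe, Free, mem_filter]
        exact ⟨mem_univ _, (hmem i.val i.isLt).2⟩
      · intro i _ i' _ h
        simp only [Fin.mk.injEq] at h
        exact Fin.ext (by omega)

/-! ### S5b — class sizes: `3·#pats_j(a) + 2 ≥ 2^{L_j}` (transport to the cube + `three_mul_card_class_add_two_ge`) -/

/-- Auxiliary `class_ge` of the local two-thirds law (planner qa-qnc0-p2 g29, `LocalTwoThirds23991.lean`, verbatim). -/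
theorem class_ge (m₀ w : ℕ) (ω : Fin n → Bool) (hω : ∀ l : Fin n, ¬ inWindow m₀ w l.val → ω l = false)
    (j : Fin 4) (a : Fin 3) :
    2 ^ (Free m₀ w j (n := n)).card ≤ 3 * (pats m₀ w ω j a).card + 2 := by
  classical
  set F : Finset (Fin n) := Free m₀ w j (n := n) with hF
  have hmemF : ∀ l : Fin n, l ∈ F ↔ ¬ inWindow m₀ w l.val ∧ segOf m₀ w l.val = j := by
    intro l; rw [hF, Free, mem_filter]; simp
  set L : ℕ := F.card with hLdef
  -- fixed (window) weight of segment `j`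
  set fix : ℕ := (univ.filter fun l : Fin n =>
    segOf m₀ w l.val = j ∧ inWindow m₀ w l.val ∧ ω l = true).card with hfix
  -- the cube `{0,1}^L` embeds as the free bits of segment `j`
  set e : F ≃ Fin L := F.equivFin with he
  set emb : (Fin L → Bool) → (Fin n → Bool) := fun v l => if h : l ∈ F then v (e ⟨l, h⟩) else ω l
    with hembdef
  have hemb_F : ∀ v : Fin L → Bool, ∀ l : Fin n, ∀ h : l ∈ F, emb v l = v (e ⟨l, h⟩) := by
    intro v l h; simp only [hembdef, h, dif_pos]
  have hemb_nF : ∀ v : Fin L → Bool, ∀ l : Fin n, l ∉ F → emb v l = ω l := by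
    intro v l h; simp only [hembdef, h, dif_neg, not_false_eq_true]
  -- (1) normalised
  have hPat : ∀ v, emb v ∈ Pat m₀ w ω j := by
    intro v
    rw [Pat, mem_filter]
    refine ⟨mem_univ _, fun l hl => ?_, fun l hl hs => ?_⟩
    · exact hemb_nF v l (fun h => ((hmemF l).1 h).1 hl)
    · rw [hemb_nF v l (fun h => hs ((hmemF l).1 h).2)]
      exact hω l hl
  -- (2) weight = fixed window weight + cube weight
  have hwt : ∀ v, wtSeg m₀ w j (emb v) = fix + wt v := by
    intro v
    unfold wtSeg
    rw [← Finset.card_filter_add_card_filter_not (fun l : Fin n => l ∈ F), add_comm]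
    congr 1
    · rw [hfix]
      congr 1
      ext l
      simp only [mem_filter, mem_univ, true_and]
      constructor
      · rintro ⟨⟨hs, hv⟩, hnF⟩
        have hwin : inWindow m₀ w l.val := by
          by_contra hnw
          exact hnF ((hmemF l).2 ⟨hnw, hs⟩)
        exact ⟨hs, hwin, by rwa [hemb_nF v l hnF] at hv⟩
      · rintro ⟨hs, hwin, hwl⟩
        have hnF : l ∉ F := fun h => ((hmemF l).1 h).1 hwin
        exact ⟨⟨hs, by rw [hemb_nF v l hnF]; exact hwl⟩, hnF⟩
    · unfold wt
      refine Finset.card_bij (fun l hl => e ⟨l, (mem_filter.1 hl).2⟩) ?_ ?_ ?_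
      · intro l hl
        have hl' := mem_filter.1 hl
        rw [mem_filter]
        refine ⟨mem_univ _, ?_⟩
        rw [← hemb_F v l hl'.2]
        exact (mem_filter.1 hl'.1).2.2
      · intro l₁ hl₁ l₂ hl₂ h
        exact congrArg Subtype.val (e.injective h)
      · intro i hi
        rw [mem_filter] at hi
        have hmem : (e.symm i).1 ∈ F := (e.symm i).2
        have hx : (⟨(e.symm i).1, hmem⟩ : F) = e.symm i := Subtype.ext rfl
        refine ⟨(e.symm i).1, ?_, ?_⟩
        · rw [mem_filter]
          refine ⟨mem_filter.2 ⟨mem_univ _, ((hmemF _).1 hmem).2, ?_⟩, hmem⟩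
          rw [hemb_F v _ hmem, hx, Equiv.apply_symm_apply]
          exact hi.2
        · rw [Equiv.apply_eq_iff_eq_symm_apply]
  -- (3) injective
  have hinj : Function.Injective emb := by
    intro v v' h
    funext i
    have hmem : (e.symm i).1 ∈ F := (e.symm i).2
    have hx : (⟨(e.symm i).1, hmem⟩ : F) = e.symm i := Subtype.ext rfl
    have := congrFun h (e.symm i).1
    rw [hemb_F v _ hmem, hemb_F v' _ hmem, hx, Equiv.apply_symm_apply] at this
    exact this
  -- (4) count: the cube class `r = a + 2·fix` lands in `pats_j(a)`
  have hcube := three_mul_card_class_add_two_ge L (a.val + 2 * fix)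
  have hle : (univ.filter fun v : Fin L → Bool => wt v % 3 = (a.val + 2 * fix) % 3).card ≤
      (pats m₀ w ω j a).card := by
    refine Finset.card_le_card_of_injOn emb ?_ (fun v _ v' _ h => hinj h)
    intro v hv
    rw [mem_coe, mem_filter] at hv
    rw [mem_coe, pats, mem_filter]
    refine ⟨hPat v, ?_⟩
    rw [hwt v]
    have h3 := hv.2
    have ha := a.isLt
    omega
  omega

/-! ### S3 — the fibre of a window word has at most `2^{Σ_j L_j}` inputs -/

/-- Auxiliary `fibre_le` of the local two-thirds law (planner qa-qnc0-p2 g29, `LocalTwoThirds23991.lean`, verbatim). -/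
theorem fibre_le (m₀ w : ℕ) (ω : Fin n → Bool) :
    (univ.filter fun u : Fin n → Bool => wproj m₀ w u = ω).card ≤ 2 ^ (∑ j : Fin 4, (Free m₀ w j (n := n)).card) := by
  classical
  set NW : Finset (Fin n) := univ.filter fun l : Fin n => ¬ inWindow m₀ w l.val with hNW
  have hcardNW : NW.card = ∑ j : Fin 4, (Free m₀ w j (n := n)).card := by
    rw [card_eq_sum_card_fiberwise (f := fun l : Fin n => segOf m₀ w l.val) (s := NW) (t := univ)
      (fun _ _ => mem_coe.mpr (mem_univ _))]
    refine Finset.sum_congr rfl fun j _ => ?_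
    rw [hNW, filter_filter]
    rfl
  have hfun : Fintype.card (NW → Bool) = 2 ^ NW.card := by
    rw [Fintype.card_fun, Fintype.card_bool, Fintype.card_coe]
  rw [← hcardNW, ← hfun, ← Finset.card_univ]
  refine Finset.card_le_card_of_injOn (fun u : Fin n → Bool => fun l : NW => u l.1)
    (fun _ _ => mem_coe.mpr (mem_univ _)) ?_
  intro u hu u' hu' h
  rw [mem_coe, mem_filter] at hu hu'
  funext l
  by_cases hl : inWindow m₀ w l.val
  · have h1 := congrFun hu.2 l
    have h2 := congrFun hu'.2 l
    simp only [wproj, hl, if_true] at h1 h2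
    rw [h1, h2]
  · have hlm : l ∈ NW := by rw [hNW, mem_filter]; exact ⟨mem_univ _, hl⟩
    exact congrFun h ⟨l, hlm⟩

/-! ### S1 — cells inject into the fibre (via `G`), losses to losses -/

/-- Auxiliary `cells_inject` of the local two-thirds law (planner qa-qnc0-p2 g29, `LocalTwoThirds23991.lean`, verbatim). -/
theorem cells_inject (m₀ w c : ℕ) (y : Fin (n + 1) → (Fin n → Bool) → Bool) (ω : Fin n → Bool)
    (hω : ∀ l : Fin n, ¬ inWindow m₀ w l.val → ω l = false) :
    (∑ a : Fin 4 → Fin 3, ((cell m₀ w ω a).filter fun x => ringWinU c y (G m₀ w x) = false).card) ≤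
      (univ.filter fun u : Fin n → Bool => ringWinU c y u = false ∧ wproj m₀ w u = ω).card := by
  classical
  -- patterns in a cell are normalised
  have hPat : ∀ a : Fin 4 → Fin 3, ∀ x ∈ cell m₀ w ω a, ∀ j, x j ∈ Pat m₀ w ω j := by
    intro a x hx j
    rw [cell, Fintype.mem_piFinset] at hx
    exact (mem_filter.1 (hx j)).1
  -- the cells are pairwise disjoint
  have hdisj : ∀ a ∈ (univ : Finset (Fin 4 → Fin 3)), ∀ a' ∈ (univ : Finset (Fin 4 → Fin 3)), a ≠ a' →
      Disjoint ((cell m₀ w ω a).filter fun x => ringWinU c y (G m₀ w x) = false)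
        ((cell m₀ w ω a').filter fun x => ringWinU c y (G m₀ w x) = false) := by
    intro a _ a' _ hne
    rw [Finset.disjoint_left]
    intro x hx hx'
    apply hne
    funext j
    rw [mem_filter, cell, Fintype.mem_piFinset] at hx hx'
    have h1 := (mem_filter.1 (hx.1 j)).2
    have h2 := (mem_filter.1 (hx'.1 j)).2
    exact Fin.ext (by rw [← h1, ← h2])
  rw [← Finset.card_biUnion hdisj]
  refine Finset.card_le_card_of_injOn (G m₀ w) ?_ ?_
  · intro x hx
    rw [mem_coe, mem_biUnion] at hx
    obtain ⟨a, _, hx⟩ := hx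
    have hP := hPat a x (mem_filter.1 hx).1
    rw [mem_coe, mem_filter]
    refine ⟨mem_univ _, (mem_filter.1 hx).2, ?_⟩
    funext l
    by_cases hl : inWindow m₀ w l.val
    · simp only [wproj, hl, if_true, G]
      have h := hP (segOf m₀ w l.val)
      rw [Pat, mem_filter] at h
      exact h.2.1 l hl
    · simp only [wproj, hl, if_false]
      exact (hω l hl).symm
  · intro x hx x' hx' h
    rw [mem_coe, mem_biUnion] at hx hx'
    obtain ⟨a, _, hx⟩ := hx
    obtain ⟨a', _, hx'⟩ := hx'
    have hP := hPat a x (mem_filter.1 hx).1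
    have hP' := hPat a' x' (mem_filter.1 hx').1
    funext j l
    have hj := hP j
    have hj' := hP' j
    rw [Pat, mem_filter] at hj hj'
    by_cases hl : inWindow m₀ w l.val
    · rw [hj.2.1 l hl, hj'.2.1 l hl]
    · by_cases hs : segOf m₀ w l.val = j
      · have := congrFun h l
        simp only [G] at this
        rw [hs] at this
        exact this
      · rw [hj.2.2 l hl hs, hj'.2.2 l hl hs]

/-! ### S4 — the averaged score of the cells (from `system_le` + `average4_le`) -/

/-- Auxiliary `cells_average` of the local two-thirds law (planner qa-qnc0-p2 g29, `LocalTwoThirds23991.lean`, verbatim). -/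
theorem cells_average (m₀ w c : ℕ) (hn : 6 * w + 4 * m₀ ≤ n) (y : Fin (n + 1) → (Fin n → Bool) → Bool)
    (hy : Radius y w) (ω : Fin n → Bool) (hne : ∀ j a, (pats m₀ w ω j a).Nonempty) :
    (∑ a : Fin 4 → Fin 3, (((cell m₀ w ω a).filter fun x => ringWinU c y (G m₀ w x) = true).card : ℝ) /
      ∏ j, ((pats m₀ w ω j (a j)).card : ℝ)) ≤ 54 := by
  refine average4_le (fun j a => pats m₀ w ω j a) (fun x => ringWinU c y (G m₀ w x) = true) hne ?_
  intro P hP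
  refine system_le m₀ w c hn y hy P ?_ ?_
  · intro i j a b l hl
    have hi := hP i a
    have hj := hP j b
    simp only [pats, Pat, mem_filter, mem_univ, true_and] at hi hj
    rw [hi.1.1 l hl, hj.1.1 l hl]
  · intro j a
    have h := hP j a
    simp only [pats, mem_filter] at h
    exact h.2

end Summit.QuantumAdvantage.AdviceFreeQNC0.OddLocal
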